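import Summits.QuantumFields.YangMills.Theorems.BalabanUVNodesSpineRates
import Summits.QuantumFields.YangMills.Theorems.BalabanUVNodesN17KnitTransfer
import Summits.QuantumFields.YangMills.Theorems.BalabanUVNodesN17KnitEdge

/-!
# BalabanUVNodes ∕ node N17 = NE4 — THE NODE IN CLUSTER K4's CURRENCY (route module 2 `BalabanUVNodesSpineRates` BY NAME): the stub
# `YMDAG.UVSplit.S_N17 RRec` ∕ the carrier statement `N17At D u` UNFOLDED, ANTITONE in the rate-record predicate, CLOSED at the carriers from
# (D4) ∧ N18 with N22 IDLE, node U2's triple and the N17 → N27 edge at the carriers' letters, the transfer road as the located binder, guards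

Cell `pub-ymgap`, HUMAN RULING D-0062 (Track A at full width), seat `pub-ymgap-dag-n17-a` (-a KNIT-BY-NAME), generation 5; companion 6 of
`BalabanUVNodesN17Knit` (p408968) ∕ `…KnitEdge` (p410452) ∕ `…KnitTransfer` (p411569) ∕ `…AtBetaOfRecord(Kernels)` (p413688, p414114) ∕
`…AtRecord8` (p417546).  THEOREMS ONLY (no `def`, no `def … : Prop`); imports the route's K4 module `YangMills/Theorems/BalabanUVNodesSpineRates.lean`
(dagwriter text, courier dag-p2, p418381, chair R424 (B) ∕ R440: `U3Carriers`, `RateCarriers`, `RateRecordPred`, `N17At`, `N18At`, `N22At`, `ReadOutAt`,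
`RatesAt`, `S_N17`, `S_N18`, `S_N22`, `S_D4`, `RateInputs`, `n17At_of_u3`, `N17_of_U3edge`) and this lineage's files 1–3; modifies nothing; every cited
lemma is used BY NAME.

THE STUB.  `YMDAG.UVSplit.S_N17 RRec := ∀ F D g₀ os R, RRec F D g₀ os R → N17At D R.u3`, `N17At D u := NE4.NE4OnData D (u.cr·u.C₅·u.θ) u.ρ u.γ`
`= T4CouplingMatching.ScaleShiftRate (u.cr·u.C₅·u.θ) u.ρ u.γ D.βfun` (:180) — row NE4 ON THE DATUM at node U3's DEPENDENT letters (read-out domination `cr`,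
NE5 constant `C₅` and rate `θ`, joint rate `ρ`, window radius `γ`), over the rate-record predicate PARAMETER `RRec : RateRecordPred N` (NODE 00's later-stage
«rate carriers OF RECORD» predicate, `--informal` until its home lands, R422 (A)(P2)).  There is no landed `RRec`; the closers below are therefore
stated for EVERY `RRec` with the named clause (the (W2) reading of the K4 «AT-RECORD» modules, as `…N14AtRecord` ∕ `…N16AtRecord` ∕ `…N22AtRecord`).
* §1 (W2) READINGS: `n17At_iff` ∕ `s_N17_iff` (`Iff.rfl`), `s_N17_antitone` (closed under refinement of `RRec`), `ratesAt_n17` (4th conjunct of K4's per-string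
  conclusion), `n17At_congr_βfun` (the node reads the datum ONLY through `D.βfun` — the Stage-9 transfer shape), `n17At_mono` ∕ `n17At_of_ne4OnData`
  (N17 has NO letters of its own at the carriers: any road's `NE4OnData D c ρ γ` dominated by the carriers' letters gives `N17At D u`).
* §2 THE IN-EDGES AT THE CARRIERS — the point of a DEPENDENT node: **`n17At_of_readOutAt`** ((D4) ∧ N18 ⇒ N17 at the carriers; row NE9 = N22, the
  read-out bound and the joint-rate clauses of `ReadOutAt` are IDLE — file 1's `N17_of_ne5_readOut_oneRate`; sharper than module 2's `n17At_of_u3`),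
  `ne4OnData_ownRate_of_readOutAt` (at NE5's OWN rate `u.θ`), **`s_N17_of_D4_N18`** (the glue `S_D4 → S_N18 → S_N17` WITHOUT `S_N22`; module 2's
  `N17_of_U3edge` takes `S_N22` idly), `u2Inputs_of_readOutAt` ∕ `u2Inputs_at_record` (node U2's WHOLE triple N17 ∧ `HistLipschitz` ∧ fading memory at the
  carriers' letters — here N22 IS used), `ratesAt_of_readOutAt`, `rateInputs_of_readOutAt` (K4's ∃-packaged conclusion from one bundle of record carrying the
  five producers' statements and (D4)).
* §3 THE OTHER ROADS AT THE CARRIERS' LETTERS (roster row n17 «IN n15, n16, (D4)»): `n17At_of_transferModel` — file 3's ONE-STEP TRANSFER ROAD («β⁰ conv +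
  β¹ shift + fading memory») lands in `N17At D u` whenever its constant `2c₀ + shiftConst …` and rate `θ` are dominated by `u.cr·u.C₅·u.θ`, `u.ρ`; its leaf
  `StepScaleShift b b_r ρ E₀ u.γ` is the one-step η-source «rows NE2∕NE3 = N15∕N16 through the step» — the LOCATED BINDER: module 2's K4 fact (a) stands
  (no tree arrow links `N15At R.ne2` ∕ `N16At R.ne3` to `StepScaleShift`; an `RRec` home wanting the roster's IN column as an arrow must carry that link).
* §4 CONSUMER FACES AT THE CARRIERS (the N17 → N27 edge, n27-a's `…N27LedgerJoinN17` reads the unbundled forms): `u2Output_under_of_readOutAt` (with the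
  AF binders and the window, output rate `u.ρ`; file 1 `u2Output_under_of_u3edge`), **`u2Output_under_of_readOutAt_gap`** (AF-FREE: any output rate
  `ρ′ ∈ ]u.ρ, 1[`, no `EventualLowerH`, no window; file 3 `u2Output_under_of_u3edge_gap`), `u2Output_under_at_record_gap` (the same at every bundle of record
  from `S_D4`, `S_N18`, `S_N22`).
* §5 GUARDS (A5∕A6 ∕ the INHABITED rider): `n17At_of_βfun_zero` ∕ `s_N17_of_βfun_zero` (at a datum with vanishing β-functions — NODE 00's zero-chart ₈C
  inhabitant, `…N17AtRecord8.exists_isRecordOfRecord₈C_N17` — the stub holds BY JUNK for every bundle with non-negative letters: an `RRec` reading such a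
  record closes `S_N17` vacuously-in-content; ref-B PIN #235), `n17At_of_one_le_rate` (A6: at a joint rate letter `u.ρ ≥ 1` the β-WINDOW alone meets the
  stub — the record must pin `u.ρ < 1`), `not_n17At_of_oscillating` ∕ **`not_s_N17_of_admits`** (REFUTED over any `RRec` admitting a bundle whose datum's
  β-family is history-free oscillating with `u.ρ < 1`, `u.γ > 0` — R422 DEFINITION FIRST: the record must pin Bałaban's β, not a β-window grade),
  `s_N17_of_empty` (VACUOUS over a predicate admitting no bundle — K4's content then sits in `S_R00x`).

HONEST FRAMING.  Kernel bookkeeping BY NAME; 0 sorry; NE4 is NOT IN PRINT ([Balaban1987RG1] (1.20)–(1.22) p. 264 give linearity in the LAST coupling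
only) and NOT PROVED; rows NE5 (N18), NE9 (N22), the (D4) read-out binders, the transfer leaves and (AF-0r) are discharged by nobody here; no `RRec` home
has landed ⇒ NOTHING here is a discharge of N17 and the count does not move.  One finite four-torus at fixed ε per run; NOT infinite volume, NOT OS on
ℝ⁴, NOT a mass gap, NOT Clay.
-/

noncomputable section

namespace YMDAG.N17

open Literature.MathematicalPhysics.QuantumFieldTheory.Balaban1983to89
open Literature.MathematicalPhysics.QuantumFieldTheory.Balaban1983to89.FlowStep
open Literature.MathematicalPhysics.QuantumFieldTheory.Balaban1983to89.T4CouplingMatching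
open Literature.MathematicalPhysics.QuantumFieldTheory.Balaban1983to89.T4Continuum
open Literature.MathematicalPhysics.QuantumFieldTheory.Balaban1983to89.T4FiniteEpsInhabited (zeroHBeta)
open Literature.MathematicalPhysics.QuantumFieldTheory.Balaban1983to89.Beta.AveragedAFCarrier.Osc (betaO)
open Summit.QuantumFields.BalabanUV.T4Continuum.Spine
open Summit.QuantumFields.BalabanUV.T4Continuum.Spine.NE4 (NE4OnData U2Inputs U2Output)
open Summit.QuantumFields.BalabanUV.T4Continuum.NE4TransferModel (StepTransferModel)
open Summit.QuantumFields.BalabanUV.T4Continuum.NE4TransferResolvent (shiftConst shiftConst_nonneg)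
open Summit.QuantumFields.YangMills.Theorems.BalabanUVNodesN17
open YMDAG.UVSplit

variable {N : ℕ} [NeZero N]

/-! ## §1 (W2) readings: the stub unfolded, antitone in `RRec`, its place in K4's per-string conclusion, what it reads -/

/-- **WHAT `N17At D u` SAYS** (`Iff.rfl`): row NE4 on the datum's OWN β-family at node U3's dependent letters —
`ScaleShiftRate (u.cr·u.C₅·u.θ) u.ρ u.γ D.βfun`, i.e. `|β_{k+2}(w) − β_{k+1}(tail w)| ≤ (cr·C₅·θ)·ρ^k` on the boxes `]0,u.γ]^{k+2}`.
[cite: Balaban1987RG1, (1.20)-(1.22) p.264] -/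
theorem n17At_iff {F : T4Family} (D : Datum F N) (u : U3Carriers) :
    N17At D u ↔ ScaleShiftRate (u.cr * u.C₅ * u.θ) u.ρ u.γ D.βfun :=
  Iff.rfl

/-- **WHAT `S_N17 RRec` SAYS** (`Iff.rfl`): at every rate-carrier bundle `R` of record (every family, datum, tuned sequence, loop string),
`ScaleShiftRate (R.u3.cr·R.u3.C₅·R.u3.θ) R.u3.ρ R.u3.γ D.βfun`. [cite: Balaban1987RG1, (1.20)-(1.22) p.264] -/
theorem s_N17_iff (RRec : RateRecordPred N) :
    S_N17 RRec ↔ ∀ (F : T4Family) (D : Datum F N) (g₀ : ℕ → ℝ) (os : List (ULoop F)) (R : RateCarriers N),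
      RRec F D g₀ os R → ScaleShiftRate (R.u3.cr * R.u3.C₅ * R.u3.θ) R.u3.ρ R.u3.γ D.βfun :=
  Iff.rfl

/-- **ANTITONE IN THE RATE-RECORD PREDICATE** [bookkeeping]: if `RRec'` refines `RRec` (every bundle of record for `RRec'` is one for `RRec`) then
`S_N17 RRec → S_N17 RRec'` — a later-stage home admitting fewer bundles closes from an earlier one by ONE application. [folklore] -/
theorem s_N17_antitone {RRec RRec' : RateRecordPred N}
    (href : ∀ (F : T4Family) (D : Datum F N) (g₀ : ℕ → ℝ) (os : List (ULoop F)) (R : RateCarriers N),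
      RRec' F D g₀ os R → RRec F D g₀ os R)
    (h : S_N17 RRec) : S_N17 RRec' :=
  fun F D g₀ os R hR => h F D g₀ os R (href F D g₀ os R hR)

/-- K4's per-string conclusion `RatesAt D R` carries N17 as its FOURTH conjunct (after N14, N15, N16; before N18, N22). [folklore] -/
theorem ratesAt_n17 {F : T4Family} {D : Datum F N} {R : RateCarriers N} (h : RatesAt D R) : N17At D R.u3 :=
  h.2.2.2.1

/-- **N17 READS THE DATUM ONLY THROUGH ITS β-FAMILY** [bookkeeping]: two data (of any two families) with the same `βfun` satisfy `N17At · u` together —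
the transfer shape along NODE 00's stage refinements (a Stage-9 record whose datum has a Stage-8 shadow with the same `βfun` inherits every N17 face). [folklore] -/
theorem n17At_congr_βfun {F F' : T4Family} {D : Datum F N} {D' : Datum F' N} (h : D.βfun = D'.βfun) (u : U3Carriers) :
    N17At D u ↔ N17At D' u := by
  rw [n17At_iff, n17At_iff, h]

/-- **N17 HAS NO LETTERS OF ITS OWN AT THE CARRIERS** [bookkeeping]: any road delivering `NE4OnData D c ρ γ` with `0 ≤ c ≤ u.cr·u.C₅·u.θ`,
`0 ≤ ρ ≤ u.ρ` on a box `γ ≥ u.γ` gives `N17At D u` (file 1 `N17_mono`: smaller boxes, worse constant and rate). [folklore] -/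
theorem n17At_of_ne4OnData {F : T4Family} (D : Datum F N) (u : U3Carriers) {c ρ γ : ℝ} (h : NE4OnData D c ρ γ) (hc : 0 ≤ c)
    (hcu : c ≤ u.cr * u.C₅ * u.θ) (hρ : 0 ≤ ρ) (hρu : ρ ≤ u.ρ) (hγ : u.γ ≤ γ) : N17At D u :=
  N17_mono D h hγ hc hcu hρ hρu

/-- **MONOTONICITY BETWEEN CARRIERS** [bookkeeping]: `N17At D u → N17At D u'` whenever `u'` has the larger dependent constant, the larger joint rate
and the smaller window (`0 ≤ u.cr·u.C₅·u.θ`, `0 ≤ u.ρ`). [folklore] -/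
theorem n17At_mono {F : T4Family} (D : Datum F N) {u u' : U3Carriers} (h : N17At D u) (hc : 0 ≤ u.cr * u.C₅ * u.θ)
    (hcc' : u.cr * u.C₅ * u.θ ≤ u'.cr * u'.C₅ * u'.θ) (hρ : 0 ≤ u.ρ) (hρρ' : u.ρ ≤ u'.ρ) (hγ : u'.γ ≤ u.γ) :
    N17At D u' :=
  N17_mono D h hγ hc hcc' hρ hρρ'

/-! ## §2 THE IN-EDGES AT THE CARRIERS: (D4) ∧ N18 ⇒ N17 (N22 idle); node U2's whole triple; K4's conclusion from one bundle -/

/-- **N17 AT THE CARRIERS ⇐ (D4) ∧ N18 — N22 IDLE (kernel, by name).**  From `ReadOutAt D u` only the window clause, `RepresentsA∕B`, the slice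
memberships, transport covariance `ReadCovariantOn … u.cr` and the signs `0 ≤ cr, C₅, θ`, `θ ≤ ρ` are used (the read-out bound `ReadBoundedOn`, `0 ≤ ω`,
`ω ≤ ρ` are idle), together with N18 = NE5 for every member of run B's first-coupling family: file 1's `N17_of_ne5_readOut_oneRate`.  Compare module 2's
`n17At_of_u3` (takes `N22At u` idly).  Rows NE5 and (D4) UNPRINTED — binders. [cite: Balaban1987RG1, (1.20)-(1.22) p.264] -/
theorem n17At_of_readOutAt {F : T4Family} (D : Datum F N) {u : U3Carriers} (hD4 : ReadOutAt D u) (h18 : N18At u) : N17At D u := by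
  obtain ⟨𝒜A, 𝒜B, rA, rB, hW, hA, hB, h𝒜A, h𝒜B, -, hcov, hcr, hC₅, hθ, -, hθρ, -⟩ := hD4
  exact N17_of_ne5_readOut_oneRate D hW h18 hA hB h𝒜A h𝒜B hcov hcr hC₅ hθ hθρ

/-- **… AT NE5's OWN RATE `u.θ`** [bookkeeping]: the same inputs give `NE4OnData D (u.cr·u.C₅·u.θ) u.θ u.γ` — the joint rate `u.ρ` (and its sign) enters
`N17At` only because node U2's companions (history moduli, fading memory at rate `ω`) are booked at ONE rate `ρ ≥ max θ ω` (file 1 `N17_of_ne5_readOut`). [folklore] -/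
theorem ne4OnData_ownRate_of_readOutAt {F : T4Family} (D : Datum F N) {u : U3Carriers} (hD4 : ReadOutAt D u) (h18 : N18At u) :
    NE4OnData D (u.cr * u.C₅ * u.θ) u.θ u.γ := by
  obtain ⟨𝒜A, 𝒜B, rA, rB, hW, hA, hB, h𝒜A, h𝒜B, -, hcov, -, -, -, -, -, -⟩ := hD4
  exact N17_of_ne5_readOut D hW h18 hA hB h𝒜A h𝒜B hcov

/-- **THE GLUE WITHOUT N22 (kernel)**: `S_D4 RRec → S_N18 RRec → S_N17 RRec` for EVERY rate-record predicate — module 2's `N17_of_U3edge` with its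
`S_N22` binder dropped.  (W2) CLOSER, refinement-generic: `S_N17` holds over every `RRec` whose bundles of record carry the slot «(D4) read-out binders ∧
NE5 b-family» at `R.u3`. [cite: Balaban1987RG1, (1.20)-(1.22) p.264] -/
theorem s_N17_of_D4_N18 (RRec : RateRecordPred N) (hD4 : S_D4 RRec) (h18 : S_N18 RRec) : S_N17 RRec :=
  fun F D g₀ os R hR => n17At_of_readOutAt D (hD4 F D g₀ os R hR) (h18 F D g₀ os R hR)

/-- **NODE U2's WHOLE INPUT TRIPLE AT THE CARRIERS' LETTERS (kernel, by name)**: (D4) ∧ N18 ∧ N22 ⇒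
`U2Inputs D (cr·C₅·θ) (cr·C₉·ω) ρ γ (k i ↦ cr·Λ(k+1) i)` — N17 ∧ `HistLipschitz` ∧ `FadingMemory` at the joint rate; HERE N22 is used
(`Spine.NE4.Targets.u2Inputs_of_u3`, the content of module 2's `n17At_of_u3` before projecting to `.ne4`).  Every input UNPRINTED. [cite: Balaban1987RG1, §5 p.298] -/
theorem u2Inputs_of_readOutAt {F : T4Family} (D : Datum F N) {u : U3Carriers} (hD4 : ReadOutAt D u) (h18 : N18At u)
    (h22 : N22At u) :
    U2Inputs D (u.cr * u.C₅ * u.θ) (u.cr * u.C₉ * u.ω) u.ρ u.γ (fun k i => u.cr * u.Λ (k + 1) i) := by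
  obtain ⟨𝒜A, 𝒜B, rA, rB, hW, hA, hB, h𝒜A, h𝒜B, hr, hcov, hcr, hC₅, hθ, hω, hθρ, hωρ⟩ := hD4
  exact NE4.u2Inputs_of_u3 D hW h18 h22.1 h22.2 hA hB h𝒜A h𝒜B hr hcov hcr hC₅ hθ hω hθρ hωρ

/-- **… AT EVERY BUNDLE OF RECORD** from the three stubs `S_D4`, `S_N18`, `S_N22` (what the β-side consumer of node U2 reads at the record). [folklore] -/
theorem u2Inputs_at_record {RRec : RateRecordPred N} (hD4 : S_D4 RRec) (h18 : S_N18 RRec) (h22 : S_N22 RRec)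
    {F : T4Family} {D : Datum F N} {g₀ : ℕ → ℝ} {os : List (ULoop F)} {R : RateCarriers N} (hR : RRec F D g₀ os R) :
    U2Inputs D (R.u3.cr * R.u3.C₅ * R.u3.θ) (R.u3.cr * R.u3.C₉ * R.u3.ω) R.u3.ρ R.u3.γ
      (fun k i => R.u3.cr * R.u3.Λ (k + 1) i) :=
  u2Inputs_of_readOutAt D (hD4 F D g₀ os R hR) (h18 F D g₀ os R hR) (h22 F D g₀ os R hR)

/-- **K4's PER-STRING CONCLUSION FROM THE FIVE PRODUCERS AND (D4)** [bookkeeping]: N14, N15, N16 at their carriers, (D4) ∧ N18 ∧ N22 at node U3's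
carriers ⇒ `RatesAt D R` (N17 derived by `n17At_of_readOutAt`). [folklore] -/
theorem ratesAt_of_readOutAt {F : T4Family} {D : Datum F N} {R : RateCarriers N} (h14 : N14At R.ne1) (h15 : N15At R.ne2)
    (h16 : N16At R.ne3) (hD4 : ReadOutAt D R.u3) (h18 : N18At R.u3) (h22 : N22At R.u3) : RatesAt D R :=
  ⟨h14, h15, h16, n17At_of_readOutAt D hD4 h18, h18, h22⟩

/-- **K4's ∃-PACKAGED HOOK FROM ONE BUNDLE OF RECORD** [bookkeeping]: a bundle `R` of record for `(D, g₀, os)` carrying the five producers' statements and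
the (D4) binders witnesses `RateInputs RRec F D g₀ os` (module 2 `rateInputs_iff`). [folklore] -/
theorem rateInputs_of_readOutAt (RRec : RateRecordPred N) {F : T4Family} {D : Datum F N} {g₀ : ℕ → ℝ} {os : List (ULoop F)}
    {R : RateCarriers N} (hR : RRec F D g₀ os R) (h14 : N14At R.ne1) (h15 : N15At R.ne2) (h16 : N16At R.ne3)
    (hD4 : ReadOutAt D R.u3) (h18 : N18At R.u3) (h22 : N22At R.u3) : RateInputs RRec F D g₀ os :=
  ⟨R, hR, ratesAt_of_readOutAt h14 h15 h16 hD4 h18 h22⟩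

/-! ## §3 THE OTHER ROADS AT THE CARRIERS' LETTERS — the one-step transfer road (roster IN n15∕n16) as the located binder -/

/-- **THE TRANSFER ROAD LANDS IN `N17At D u` (kernel, by name).**  File 3's `N17_of_transferModel` — (AF-0r) `|β⁰_{k+1} − β⁰_∞| ≤ c₀θ^k` for the PRINTED
one-loop split `S` of `D.βfun` ([Balaban1987RG1] (2.12)–(2.14) p. 268) and a one-step transfer model `M` on the window `]0, u.γ]` with its four leaves
(`TransferBound`, `ActivityLipschitz` — PRINTED TYPES [II] (1.36), (2.14)∕(2.38); `Admissible` = (B) by type; `StepScaleShift b b_r ρ E₀ u.γ` = THE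
ONE-STEP η-SOURCE «rows NE2∕NE3 = N15∕N16 through the step», NOT PRINTED) — gives `NE4OnData D (2c₀ + shiftConst …) θ u.γ`; if the carriers' dependent
letters dominate, `2c₀ + shiftConst … ≤ u.cr·u.C₅·u.θ` and `θ ≤ u.ρ`, this IS `N17At D u` (§1 `n17At_of_ne4OnData`).  LOCATED BINDER for the roster's
IN column «n15, n16»: no tree arrow produces `StepScaleShift` from `N15At R.ne2` ∕ `N16At R.ne3` (module 2, K4 fact (a)).
[cite: Balaban1987RG1, (2.12)-(2.14) p.268; Balaban1988RG2Cluster, Lemma 1 (1.33)-(1.36) p.9] -/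
theorem n17At_of_transferModel {F : T4Family} (D : Datum F N) (u : U3Carriers) (S : B12Beta.OneLoopSplit D.βfun)
    {𝔅 𝔸 : Type*} [NormedAddCommGroup 𝔅] [NormedSpace ℝ 𝔅] [NormedAddCommGroup 𝔸] [NormedSpace ℝ 𝔸]
    (M : StepTransferModel 𝔅 𝔸) {C_W ω C_F C_r E₀ b b_r ρ θ binf c₀ : ℝ}
    (hRep : M.Represents u.γ) (hRead : M.ReadsRemainder S u.γ) (hT : M.TransferBound C_W ω u.γ)
    (hA : M.ActivityLipschitz C_F C_r E₀ u.γ) (hAdm : M.Admissible E₀ u.γ) (hS : M.StepScaleShift b b_r ρ E₀ u.γ)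
    (hCF : 0 ≤ C_F) (hCr : 0 ≤ C_r) (hCW : 0 ≤ C_W) (hE₀ : 0 ≤ E₀) (hω : 0 ≤ ω) (hb : 0 ≤ b) (hbr : 0 ≤ b_r)
    (hρ : 0 ≤ ρ) (hρθ : ρ ≤ θ) (hνθ : ω + C_F * C_W < θ) (hθ1 : θ ≤ 1) (hc₀ : 0 ≤ c₀)
    (hconv : ∀ k, |S.β0 k - binf| ≤ c₀ * θ ^ k)
    (hcu : 2 * c₀ + shiftConst b b_r C_F C_r C_W E₀ ω θ ≤ u.cr * u.C₅ * u.θ) (hθu : θ ≤ u.ρ) : N17At D u :=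
  have h0 : 0 ≤ shiftConst b b_r C_F C_r C_W E₀ ω θ := shiftConst_nonneg hb hbr hCF hCr hCW hE₀ hνθ
  n17At_of_ne4OnData D u
    (N17_of_transferModel D S M hRep hRead hT hA hAdm hS hCF hCr hCW hE₀ hω hb hbr hρ hρθ hνθ hθ1 hc₀ hconv)
    (by linarith) hcu (hρ.trans hρθ) hθu le_rfl

/-! ## §4 CONSUMER FACES AT THE CARRIERS — the N17 → N27 edge (node U2's output under the targets' prefix) -/

/-- **N17 → N27 AT THE CARRIERS, WITH THE ASYMPTOTIC-FREEDOM BINDERS** [bookkeeping]: (D4) ∧ N18 ∧ N22 at `u`, an eventual lower bound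
`EventualLowerH b u.γ k₀ D.βfun` (`b > 0`), the printed-type upper bound `BetaUpperH β′ u.γ D.βfun` with `u.γ²β′ < 1`, `0 < u.ρ < 1`, `0 < u.γ` and the window
`cr·C₉·ω·((k₀+1)γ³ + 2γ∕b) ≤ (1−ρ)∕2` give `D.UnderHypotheses Hβ (g₀ ↦ U2Output D g₀ (2(cr·C₅·θ)∕(1−ρ)) ρ)` — file 1 `u2Output_under_of_u3edge`.
Every β-side binder UNPRINTED. [cite: Balaban1987RG1, Thm 2 p.259 and (0.20) p.256] -/
theorem u2Output_under_of_readOutAt {F : T4Family} (D : Datum F N) {u : U3Carriers} {Hβ : Prop} {b β' : ℝ} {k₀ : ℕ}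
    (hD4 : ReadOutAt D u) (h18 : N18At u) (h22 : N22At u) (hρ0 : 0 < u.ρ) (hρ1 : u.ρ < 1) (hγ : 0 < u.γ) (hb : 0 < b)
    (hlo : EventualLowerH b u.γ k₀ D.βfun) (hhi : BetaUpperH β' u.γ D.βfun) (hγβ : u.γ ^ 2 * β' < 1)
    (hsmall : u.cr * u.C₉ * u.ω * (((k₀ : ℝ) + 1) * u.γ ^ 3 + 2 * u.γ / b) ≤ (1 - u.ρ) / 2) :
    D.UnderHypotheses Hβ fun g₀ => U2Output D g₀ (2 * (u.cr * u.C₅ * u.θ) / (1 - u.ρ)) u.ρ := by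
  obtain ⟨𝒜A, 𝒜B, rA, rB, hW, hA, hB, h𝒜A, h𝒜B, hr, hcov, hcr, hC₅, hθ, hω, hθρ, hωρ⟩ := hD4
  exact u2Output_under_of_u3edge D hW h18 h22 hA hB h𝒜A h𝒜B hr hcov hcr hC₅ hθ hω hθρ hωρ hρ0 hρ1 hγ hb hlo hhi hγβ
    hsmall

/-- **N17 → N27 AT THE CARRIERS, AF-FREE (kernel, by name)**: (D4) ∧ N18 ∧ N22 at `u`, the printed-type upper bound with `u.γ²β′ < 1`, `0 < u.γ` and ANY
output rate `ρ′ ∈ ]u.ρ, 1[` give `D.UnderHypotheses Hβ (g₀ ↦ U2Output D g₀ (2(cr·C₅·θ)∕(1−ρ′)) ρ′)` — NO `EventualLowerH`, NO `b`, NO `k₀`, NO window;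
the price is the rate loss `ρ ↦ ρ′` (file 3 `u2Output_under_of_u3edge_gap`).  This is the edge form n27-a's `…N27LedgerJoinN17` consumes. [cite: Balaban1987RG1, Thm 2 p.259 and (0.20) p.256] -/
theorem u2Output_under_of_readOutAt_gap {F : T4Family} (D : Datum F N) {u : U3Carriers} {Hβ : Prop} {ρ' β' : ℝ}
    (hD4 : ReadOutAt D u) (h18 : N18At u) (h22 : N22At u) (hρρ' : u.ρ < ρ') (hρ'1 : ρ' < 1) (hγ : 0 < u.γ)
    (hhi : BetaUpperH β' u.γ D.βfun) (hγβ : u.γ ^ 2 * β' < 1) :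
    D.UnderHypotheses Hβ fun g₀ => U2Output D g₀ (2 * (u.cr * u.C₅ * u.θ) / (1 - ρ')) ρ' := by
  obtain ⟨𝒜A, 𝒜B, rA, rB, hW, hA, hB, h𝒜A, h𝒜B, hr, hcov, hcr, hC₅, hθ, hω, hθρ, hωρ⟩ := hD4
  exact u2Output_under_of_u3edge_gap D hW h18 h22 hA hB h𝒜A h𝒜B hr hcov hcr hC₅ hθ hω hθρ hωρ hρρ' hρ'1 hγ hhi hγβ

/-- **… AT EVERY BUNDLE OF RECORD, AF-FREE** from `S_D4`, `S_N18`, `S_N22` [bookkeeping]: the N17 → N27 edge in cluster K4's currency — what K5's glue may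
cite per bundle `R` of record (upper bound (U) and `ρ′ ∈ ]R.u3.ρ, 1[` supplied by the consumer). [folklore] -/
theorem u2Output_under_at_record_gap {RRec : RateRecordPred N} (hD4 : S_D4 RRec) (h18 : S_N18 RRec) (h22 : S_N22 RRec)
    {F : T4Family} {D : Datum F N} {g₀ : ℕ → ℝ} {os : List (ULoop F)} {R : RateCarriers N} (hR : RRec F D g₀ os R)
    {Hβ : Prop} {ρ' β' : ℝ} (hρρ' : R.u3.ρ < ρ') (hρ'1 : ρ' < 1) (hγ : 0 < R.u3.γ) (hhi : BetaUpperH β' R.u3.γ D.βfun)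
    (hγβ : R.u3.γ ^ 2 * β' < 1) :
    D.UnderHypotheses Hβ fun g₀' => U2Output D g₀' (2 * (R.u3.cr * R.u3.C₅ * R.u3.θ) / (1 - ρ')) ρ' :=
  u2Output_under_of_readOutAt_gap D (hD4 F D g₀ os R hR) (h18 F D g₀ os R hR) (h22 F D g₀ os R hR) hρρ' hρ'1 hγ hhi hγβ

/-! ## §5 GUARDS — junk inhabitant (zero β), the rate pin `ρ < 1`, refuted over a predicate admitting a history-free β, vacuous over the empty one -/

/-- **JUNK INHABITANT** [bookkeeping]: at a datum whose β-functions VANISH (NODE 00's zero-chart Stage-8 inhabitant, `…N17AtRecord8.exists_isRecordOfRecord₈C_N17`;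
the tree's `stubData`) `N17At D u` holds for EVERY carrier bundle with `0 ≤ u.cr·u.C₅·u.θ`, `0 ≤ u.ρ` (file 1 `N17_of_betaZero`) — truth without content. [folklore] -/
theorem n17At_of_βfun_zero {F : T4Family} (D : Datum F N) (hD : D.βfun = zeroHBeta) (u : U3Carriers)
    (hc : 0 ≤ u.cr * u.C₅ * u.θ) (hρ : 0 ≤ u.ρ) : N17At D u :=
  N17_of_betaZero D (fun k v => by simp [hD, zeroHBeta]) u.γ hc hρ

/-- **… SO A RATE RECORD READING A ZERO-β DATUM CLOSES `S_N17` BY JUNK** [bookkeeping]: if every bundle of record sits at a datum with vanishing β-functions and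
carries non-negative letters, `S_N17 RRec` — ref-B's PIN (READ #235): the record predicate an `RRec` home reads must carry the chart clause of record
(`Node00.IsRecordOfRecord₈X`, `2 ≤ N`) before an N17-at-record form has content. [folklore] -/
theorem s_N17_of_βfun_zero (RRec : RateRecordPred N)
    (h : ∀ (F : T4Family) (D : Datum F N) (g₀ : ℕ → ℝ) (os : List (ULoop F)) (R : RateCarriers N),
      RRec F D g₀ os R → D.βfun = zeroHBeta ∧ 0 ≤ R.u3.cr * R.u3.C₅ * R.u3.θ ∧ 0 ≤ R.u3.ρ) :
    S_N17 RRec := fun F D g₀ os R hR =>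
  have h' := h F D g₀ os R hR
  n17At_of_βfun_zero D h'.1 R.u3 h'.2.1 h'.2.2

/-- **A6 — THE RATE PIN** [bookkeeping]: at a joint-rate letter `u.ρ ≥ 1` the β-WINDOW alone meets the stub: `BetaLowerH b u.γ` ∧ `BetaUpperH β′ u.γ` on
`D.βfun` and `β′ − b ≤ u.cr·u.C₅·u.θ` give `N17At D u` (file 2 `N17_of_betaWindow_one_le`) — so the `RRec` home must pin `R.u3.ρ < 1` (and `0 < R.u3.γ`),
else the stub carries no η-rate. [cite: Balaban1987RG1, (1.1) p.264] -/
theorem n17At_of_one_le_rate {F : T4Family} (D : Datum F N) (u : U3Carriers) {b β' : ℝ} (hlo : BetaLowerH b u.γ D.βfun)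
    (hhi : BetaUpperH β' u.γ D.βfun) (hρ : 1 ≤ u.ρ) (hcu : β' - b ≤ u.cr * u.C₅ * u.θ) : N17At D u := by
  intro k w hw
  exact (N17_of_betaWindow_one_le D hlo hhi hρ k w hw).trans
    (mul_le_mul_of_nonneg_right hcu (pow_nonneg (zero_le_one.trans hρ) k))

/-- **REFUTED AT A HISTORY-FREE OSCILLATING β** [bookkeeping]: at ANY datum whose β-family is `β_{k+1} = s + c·(−1)^k` (`Osc.betaO s c`, `0 < c`) `N17At D u`
FAILS for every carrier bundle with `u.ρ < 1`, `0 < u.γ` — whatever the dependent constant (file 1 `not_N17_of_oscillating`); such a datum still carries every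
β-WINDOW grade (`oscillating_betaWindow`). [folklore] -/
theorem not_n17At_of_oscillating {F : T4Family} (D : Datum F N) {s c : ℝ} (hD : D.βfun = betaO s c) (hc : 0 < c) (u : U3Carriers)
    (hρ : u.ρ < 1) (hγ : 0 < u.γ) : ¬ N17At D u :=
  not_N17_of_oscillating D hD hc hρ hγ _

/-- **`S_N17 RRec` IS REFUTED OVER ANY PREDICATE ADMITTING A BUNDLE WITHOUT N17** [bookkeeping] — in particular one whose datum's β-family is history-free
oscillating with `R.u3.ρ < 1`, `0 < R.u3.γ` (`not_n17At_of_oscillating`).  R422 DEFINITION FIRST at node level: the rate record must pin Bałaban's β (NODE 00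
Stage ≥ 8 with chart), not a β-window grade. [folklore] -/
theorem not_s_N17_of_admits (RRec : RateRecordPred N) {F : T4Family} {D : Datum F N} {g₀ : ℕ → ℝ} {os : List (ULoop F)}
    {R : RateCarriers N} (hR : RRec F D g₀ os R) (hnot : ¬ N17At D R.u3) : ¬ S_N17 RRec :=
  fun h => hnot (h F D g₀ os R hR)

/-- **VACUOUS OVER THE EMPTY PREDICATE** [bookkeeping]: a rate-record predicate admitting NO bundle satisfies `S_N17` trivially — the reason the (W2) reading
asks for the inhabited rider: K4's content then sits in `S_R00x` (existence of bundles of record). [folklore] -/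
theorem s_N17_of_empty : S_N17 (N := N) fun _ _ _ _ _ => False :=
  fun _ _ _ _ _ h => h.elim

end YMDAG.N17

end
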